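import Summits.SmoothPoincare4.SmoothPoincare4.Theorems.SullivanDualWitnessChargeDefs
import Summits.SmoothPoincare4.SmoothPoincare4.Theorems.SymplecticOrigamiGromovRecognitionRelEndGluedFamilyHomotopic
import Mathlib.Topology.Homotopy.Contractible

/-!
# Stub `stub_sphereHomotopy` of crux `WitnessCharge` (stmt-SmoothPoincare4-7824), line `Sketch`
(skeleton v15, lead c8) — part 1: generic two-chart homotopy lemmas

The stub `stub_sphereHomotopy` says that the glued map `ℂP¹ → X` of a compactified pencil member
(two-chart pair `(sphereU, sphereV)`, `V w = U w⁻¹`) is homotopic to that of the far flat line.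
This file contains the five pieces of pure topology the proof is assembled from (registered
helpers of the crux, all prefixed `helper_sphereHomotopy_`):

* `helper_sphereHomotopy_family`: glued maps of the two ends `s = 0`, `s = 1` of a family of
  two-chart pairs `(U s, V s)`, `s ∈ [0, 1]`, jointly continuous on `[0,1] × ℂ`, are homotopic —
  the `[0,1]`-parametrised form of `helper_gluedFamilyHomotopic` (crux `GromovRecognitionRelEnd`),
  obtained from it by clamping `a ↦ max 0 (min 1 (re a))`;
* `helper_sphereHomotopy_extendInv`: a jointly continuous deformation `W (s, ·)` of ONE chart that
  is stationary (`= g ∘ (·)⁻¹`) outside the disc `‖w‖ < R` extends, by `ζ ↦ W (s, ζ⁻¹)` and `g` on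
  `‖ζ‖ ≤ R⁻¹`, to a jointly continuous deformation of the complementary chart;
* `helper_sphereHomotopy_relBoundary`: in a contractible space two maps `f`, `g`, continuous on a
  set `A` and equal where a continuous `μ : Z → [0, 1]` is `< 1`, are joined by a homotopy
  (continuous on `[0,1] × A`) that is stationary where `μ = 0`: contract `f` along the contraction
  `h` of the space by the amount `μ · 4s(1-s)`, switch from `f` to `g` at `s = 1/2` (where either
  `μ = 1` and both sit at the apex, or `f = g`), and come back;
* `helper_sphereHomotopy_stage2`: the second deformation of the stub: a continuous map of the
  plane into `X` that takes the closed unit disc into the image of a contractible open piece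
  `ι(P)` is deformed, through maps equal to it on `‖ζ‖ ≥ 1`, to any other such map agreeing with
  it on `‖ζ‖ ≥ 2/3` (`helper_sphereHomotopy_relBoundary` pulled back by `ιinv`, pushed by `ι`);
* `helper_sphereHomotopy_keyEstimate`: the cone estimate keeping the slid `V`-disc off the added
  line: for `τ ∈ [0,1]`, `0 < lam, lamf`, `‖lam / w‖ ≥ 2`, `‖z - lam / w‖ ≤ 1`,
  `(1 - τ) z⁻¹ + τ w / lamf ≠ 0`.

References: D. McDuff, D. Salamon, *J-holomorphic Curves and Symplectic Topology*, 2nd ed. (2012),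
§4.2 (two-chart spheres); A. Hatcher, *Algebraic Topology* (2002), Ch. 0 (homotopies rel a
subspace in contractible spaces).
-/

noncomputable section

-- the prescribed namespace `Summit.<P>.<Sub>.…` duplicates `SmoothPoincare4` (P = Sub)
set_option linter.dupNamespace false

open scoped Manifold ContDiff Topology unitInterval
open Set Filter Literature.Geometry.Symplectic Literature.Topology.FourManifolds
  Literature.Topology.FourManifolds.ComplexProjectiveSpace

namespace Summit.SmoothPoincare4.SmoothPoincare4.Theorems.WitnessCharge.PencilIncompleteness

/-! ### Families of two-chart pairs over `[0, 1]` -/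

/-- **Glued maps of the two ends of a `[0,1]`-family of two-chart pairs are homotopic.** For
jointly continuous `U V : [0,1] × ℂ → X` with `V (s, z) = U (s, z⁻¹)` (`z ≠ 0`) and glued maps
`F₀` of `(U 0, V 0)`, `F₁` of `(U 1, V 1)`: `F₀ ≃ F₁`. Reduced to `helper_gluedFamilyHomotopic`
(family over the ball `‖a‖ < 2` of `ℂ` obtained by clamping `re a` to `[0, 1]`). -/
theorem helper_sphereHomotopy_family : ∀ (X : Type) [TopologicalSpace X] (U V : unitInterval × ℂ → X) (F₀ F₁ : C(ComplexProjectiveSpace 1, X)), Continuous U → Continuous V → (∀ (s : unitInterval) (z : ℂ), z ≠ 0 → V (s, z) = U (s, z⁻¹)) → (∀ q, CoordNeZero 0 q → F₀ q = U (0, affineCoordComplex 0 q 0)) → (∀ q, CoordNeZero 1 q → F₀ q = V (0, affineCoordComplex 1 q 0)) → (∀ q, CoordNeZero 0 q → F₁ q = U (1, affineCoordComplex 0 q 0)) → (∀ q, CoordNeZero 1 q → F₁ q = V (1, affineCoordComplex 1 q 0)) → F₀.Homotopic F₁ := by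
  intro X _ U V F₀ F₁ hU hV hUV h0₀ h1₀ h0₁ h1₁
  -- clamp `re a` to `[0, 1]`
  set π : ℂ → I := fun a => Set.projIcc 0 1 zero_le_one a.re with hπ_def
  have hπ : Continuous π := continuous_projIcc.comp Complex.continuous_re
  have hπ0 : π 0 = 0 := Subtype.ext (by simp [hπ_def, Set.projIcc])
  have hπ1 : π 1 = 1 := Subtype.ext (by simp [hπ_def, Set.projIcc])
  refine GromovRecognitionRelEnd.CrossCapLaurent.helper_gluedFamilyHomotopic X 2
    (fun a z => U (π a, z)) (fun a z => V (π a, z)) 0 1 F₀ F₁ (by simp) (by simp) ?_ ?_ ?_ ?_ ?_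
    ?_ ?_
  · exact (hU.comp ((hπ.comp continuous_fst).prodMk continuous_snd)).continuousOn
  · exact (hV.comp ((hπ.comp continuous_fst).prodMk continuous_snd)).continuousOn
  · intro a _ z hz
    exact hUV _ z hz
  · intro q hq
    rw [hπ0]
    exact h0₀ q hq
  · intro q hq
    rw [hπ0]
    exact h1₀ q hq
  · intro q hq
    rw [hπ1]
    exact h0₁ q hq
  · intro q hq
    rw [hπ1]
    exact h1₁ q hq

/-! ### Extending a one-chart deformation to the complementary chart -/

/-- **Extension of a stationary-at-infinity deformation of one chart to the other chart.** If
`W : [0,1] × ℂ → X` is jointly continuous and `W (s, w) = g w⁻¹` whenever `‖w‖ ≥ R` (`R > 0`,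
`g` continuous), then `Wc (s, ζ) := g ζ` for `‖ζ‖ ≤ R⁻¹` and `:= W (s, ζ⁻¹)` otherwise is jointly
continuous, and `(Wc (s, ·), W (s, ·))` is a two-chart pair: `W (s, z) = Wc (s, z⁻¹)` for
`z ≠ 0`. [folklore] -/
theorem helper_sphereHomotopy_extendInv : ∀ (X : Type) [TopologicalSpace X] (W : unitInterval × ℂ → X) (g : ℂ → X) (R : ℝ), Continuous W → Continuous g → 0 < R → (∀ (s : unitInterval) (w : ℂ), R ≤ ‖w‖ → W (s, w) = g w⁻¹) → ∃ Wc : unitInterval × ℂ → X, Continuous Wc ∧ (∀ (s : unitInterval) (z : ℂ), z ≠ 0 → W (s, z) = Wc (s, z⁻¹)) ∧ (∀ (s : unitInterval) (z : ℂ), ‖z‖ ≤ R⁻¹ → Wc (s, z) = g z) := by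
  intro X _ W g R hW hg hR hWg
  classical
  refine ⟨fun q => if ‖q.2‖ ≤ R⁻¹ then g q.2 else W (q.1, q.2⁻¹), ?_, ?_, fun s z hz => if_pos hz⟩
  · refine continuous_if_le (continuous_norm.comp continuous_snd) continuous_const
      (hg.comp continuous_snd).continuousOn ?_ ?_
    · refine hW.comp_continuousOn (continuousOn_fst.prodMk (continuousOn_snd.inv₀ ?_))
      rintro ⟨s, z⟩ (hz : R⁻¹ ≤ ‖z‖)
      exact norm_pos_iff.1 ((inv_pos.2 hR).trans_le hz)
    · rintro ⟨s, z⟩ (hz : ‖z‖ = R⁻¹)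
      have hz0 : z ≠ 0 := norm_pos_iff.1 (by rw [hz]; exact inv_pos.2 hR)
      show g z = W (s, z⁻¹)
      rw [hWg s z⁻¹ (by rw [norm_inv, hz, inv_inv]), inv_inv]
  · intro s z hz
    show W (s, z) = if ‖z⁻¹‖ ≤ R⁻¹ then g z⁻¹ else W (s, z⁻¹⁻¹)
    split_ifs with h
    · rw [norm_inv] at h
      exact hWg s z ((inv_le_inv₀ (norm_pos_iff.2 hz) hR).1 h)
    · rw [inv_inv]

/-! ### Homotopies with stationary boundary in a contractible space -/

/-- **Rel-boundary homotopies in a contractible space.** Let `P` be contractible, `f g : Z → P`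
continuous on `A`, `μ : Z → [0, 1]` continuous with `f = g` on `{μ < 1} ∩ A`. Then there is
`H : [0,1] × Z → P`, continuous on `[0,1] × A`, with `H (0, ·) = f`, `H (1, ·) = g`, and
`H (s, z) = f z` for `z ∈ A` with `μ z = 0`: with a contraction `h` of `P` (`h (0, ·) = id`,
`h (1, ·) = x₀`), `H (s, z) = h (μ z · 4s(1-s), f z)` for `s ≤ 1/2` and the same with `g` for
`s ≥ 1/2` (at `s = 1/2` either `μ z = 1`, both values being `x₀`, or `f z = g z`). [folklore] -/
theorem helper_sphereHomotopy_relBoundary : ∀ (Z P : Type) [TopologicalSpace Z] [TopologicalSpace P] [ContractibleSpace P] (A : Set Z) (f g : Z → P) (μ : Z → ℝ), ContinuousOn f A → ContinuousOn g A → Continuous μ → (∀ z, 0 ≤ μ z) → (∀ z, μ z ≤ 1) → (∀ z ∈ A, μ z < 1 → f z = g z) → ∃ H : unitInterval × Z → P, ContinuousOn H (Set.univ ×ˢ A) ∧ (∀ z, H (0, z) = f z) ∧ (∀ z, H (1, z) = g z) ∧ (∀ (s : unitInterval), ∀ z ∈ A, μ z = 0 → H (s, z) = f z) := by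
  intro Z P _ _ _ A f g μ hf hg hμ hμ0 hμ1 hfg
  classical
  obtain ⟨x₀, ⟨h⟩⟩ := id_nullhomotopic P
  -- the amount of contraction: `μ z · 4 s (1 - s)`
  have hbump : ∀ s : I, 4 * (s : ℝ) * (1 - s) ∈ I := fun s =>
    ⟨by nlinarith [s.2.1, s.2.2], by nlinarith [s.2.1, s.2.2, sq_nonneg (2 * (s : ℝ) - 1)]⟩
  set θ : I × Z → I := fun q => ⟨μ q.2 * (4 * (q.1 : ℝ) * (1 - q.1)),
    unitInterval.mul_mem ⟨hμ0 q.2, hμ1 q.2⟩ (hbump q.1)⟩ with hθ_def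
  have hθ : Continuous θ := by
    refine Continuous.subtype_mk ?_ _
    fun_prop
  have hθ0 : ∀ z, θ (0, z) = 0 := fun z => Subtype.ext (by simp [hθ_def])
  have hθ1 : ∀ z, θ (1, z) = 0 := fun z => Subtype.ext (by simp [hθ_def])
  refine ⟨fun q => if (q.1 : ℝ) ≤ 1 / 2 then h (θ q, f q.2) else h (θ q, g q.2), ?_, ?_, ?_, ?_⟩
  · refine ContinuousOn.if ?_ ?_ ?_
    · rintro ⟨s, z⟩ ⟨⟨-, hz : z ∈ A⟩, hfr⟩
      have hs : (s : ℝ) = 1 / 2 :=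
        frontier_le_subset_eq (continuous_subtype_val.comp continuous_fst) continuous_const hfr
      rcases (hμ1 z).eq_or_lt with h1 | h1
      · have hθ1' : θ (s, z) = 1 := Subtype.ext (by simp [hθ_def, hs, h1]; norm_num)
        simp only [hθ1', ContinuousMap.Homotopy.apply_one, ContinuousMap.const_apply]
      · simp only [hfg z hz h1]
    · exact h.continuous.comp_continuousOn
        ((hθ.continuousOn).prodMk (hf.comp continuousOn_snd fun q hq => hq.1.2))
    · exact h.continuous.comp_continuousOn
        ((hθ.continuousOn).prodMk (hg.comp continuousOn_snd fun q hq => hq.1.2))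
  · intro z
    have h0 : ((0 : I) : ℝ) ≤ 1 / 2 := by norm_num
    simp only [h0, if_true, hθ0, ContinuousMap.Homotopy.apply_zero, ContinuousMap.id_apply]
  · intro z
    have h1 : ¬ ((1 : I) : ℝ) ≤ 1 / 2 := by norm_num
    simp only [h1, if_false, hθ1, ContinuousMap.Homotopy.apply_zero, ContinuousMap.id_apply]
  · intro s z hz hμz
    have hθz : θ (s, z) = 0 := Subtype.ext (by simp [hθ_def, hμz])
    dsimp only
    split_ifs
    · rw [hθz, ContinuousMap.Homotopy.apply_zero, ContinuousMap.id_apply]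
    · rw [hθz, ContinuousMap.Homotopy.apply_zero, ContinuousMap.id_apply,
        hfg z hz (by rw [hμz]; exact one_pos)]

/-! ### Moving a disc inside a contractible open piece, rel its boundary circle -/

/-- **Stage 2 of the sphere homotopy.** Let `ι : P → X` be continuous with `P` contractible and a
left inverse `ιinv` continuous on `range ι`, and let `Umid Uf : ℂ → X` be continuous, equal on
`‖ζ‖ ≥ 2/3`, with `Umid` mapping the closed unit disc and `Uf` mapping everything into `range ι`.
Then there is a jointly continuous deformation from `Umid` to `Uf`, stationary (`= Uf`) on
`‖ζ‖ ≥ 1`: pull back to `P` by `ιinv`, apply `helper_sphereHomotopy_relBoundary` with the cutoff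
`μ(ζ) = max 0 (min 1 (3 - 3‖ζ‖))`, push forward by `ι`, and extend by `Uf` off the disc. [folklore] -/
theorem helper_sphereHomotopy_stage2 : ∀ (X P : Type) [TopologicalSpace X] [TopologicalSpace P] [ContractibleSpace P] (ι : P → X) (ιinv : X → P) (Umid Uf : ℂ → X), Continuous ι → ContinuousOn ιinv (Set.range ι) → (∀ x, ιinv (ι x) = x) → Continuous Umid → Continuous Uf → (∀ ζ : ℂ, 2 / 3 ≤ ‖ζ‖ → Umid ζ = Uf ζ) → (∀ ζ : ℂ, ‖ζ‖ ≤ 1 → Umid ζ ∈ Set.range ι) → (∀ ζ : ℂ, Uf ζ ∈ Set.range ι) → ∃ W : unitInterval × ℂ → X, Continuous W ∧ (∀ ζ, W (0, ζ) = Umid ζ) ∧ (∀ ζ, W (1, ζ) = Uf ζ) ∧ (∀ (s : unitInterval) (ζ : ℂ), 1 ≤ ‖ζ‖ → W (s, ζ) = Uf ζ) := by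
  intro X P _ _ _ ι ιinv Umid Uf hι hιinv hιinvι hUmid hUf heq hmid hfar
  classical
  -- the cutoff
  set μ : ℂ → ℝ := fun ζ => max 0 (min 1 (3 - 3 * ‖ζ‖)) with hμ_def
  have hμc : Continuous μ := by
    simp only [hμ_def]
    fun_prop
  have hμ0 : ∀ ζ, 0 ≤ μ ζ := fun ζ => le_max_left _ _
  have hμ1 : ∀ ζ, μ ζ ≤ 1 := fun ζ => max_le zero_le_one (min_le_left _ _)
  have hμlt : ∀ ζ, μ ζ < 1 → 2 / 3 ≤ ‖ζ‖ := by
    intro ζ h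
    by_contra h'
    have h1 : μ ζ = 1 := by
      simp only [hμ_def]
      rw [min_eq_left (by linarith), max_eq_right zero_le_one]
    exact h.ne h1
  have hμzero : ∀ ζ, 1 ≤ ‖ζ‖ → μ ζ = 0 := fun ζ h => by
    simp only [hμ_def]
    exact max_eq_left ((min_le_right _ _).trans (by linarith))
  -- `ι ∘ ιinv = id` on `range ι`
  have hιι : ∀ y ∈ range ι, ι (ιinv y) = y := by
    rintro _ ⟨x, rfl⟩
    rw [hιinvι]
  have hf : ContinuousOn (fun ζ => ιinv (Umid ζ)) (Metric.closedBall 0 1) :=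
    hιinv.comp hUmid.continuousOn fun ζ hζ => hmid ζ (mem_closedBall_zero_iff.1 hζ)
  have hg : ContinuousOn (fun ζ => ιinv (Uf ζ)) (Metric.closedBall 0 1) :=
    hιinv.comp hUf.continuousOn fun ζ _ => hfar ζ
  obtain ⟨H, hHc, hH0, hH1, hHμ⟩ := helper_sphereHomotopy_relBoundary ℂ P (Metric.closedBall 0 1)
    (fun ζ => ιinv (Umid ζ)) (fun ζ => ιinv (Uf ζ)) μ hf hg hμc hμ0 hμ1
    (fun ζ _ h => by simp only [heq ζ (hμlt ζ h)])
  -- on the unit circle the pushed-forward homotopy is `Uf`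
  have hbd : ∀ (s : I) (ζ : ℂ), ‖ζ‖ = 1 → ι (H (s, ζ)) = Uf ζ := fun s ζ hζ => by
    rw [hHμ s ζ (mem_closedBall_zero_iff.2 hζ.le) (hμzero ζ hζ.ge), hιι _ (hmid ζ hζ.le),
      heq ζ (by rw [hζ]; norm_num)]
  refine ⟨fun q => if ‖q.2‖ ≤ 1 then ι (H q) else Uf q.2, ?_, ?_, ?_, ?_⟩
  · refine continuous_if_le (continuous_norm.comp continuous_snd) continuous_const
      (hι.comp_continuousOn (hHc.mono fun q hq => ⟨mem_univ _, mem_closedBall_zero_iff.2 hq⟩))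
      (hUf.comp continuous_snd).continuousOn ?_
    rintro ⟨s, ζ⟩ hζ
    exact hbd s ζ hζ
  · intro ζ
    dsimp only
    split_ifs with h
    · rw [hH0, hιι _ (hmid ζ h)]
    · exact (heq ζ (by linarith [not_le.1 h])).symm
  · intro ζ
    dsimp only
    split_ifs with h
    · rw [hH1, hιι _ (hfar ζ)]
    · rfl
  · intro s ζ hζ
    dsimp only
    split_ifs with h
    · exact hbd s ζ (le_antisymm h hζ)
    · rfl

/-! ### The cone estimate for the slid `V`-disc -/

/-- **Cone estimate.** For `τ ∈ [0, 1]`, `0 < lam`, `0 < lamf`, `w ≠ 0` with `‖lam / w‖ ≥ 2` and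
`‖z - lam / w‖ ≤ 1`: `(1 - τ) z⁻¹ + τ w / lamf ≠ 0`. With `ξ = lam / w`, `z = ξ + e`, `‖e‖ ≤ 1`,
`κ = lam / lamf > 0`: multiplying by `z ξ` gives `(1 - τ + τκ) ξ + τκ e`, of norm at least
`2 (1 - τ + τκ) - τκ = 2 (1 - τ) + τκ > 0`. [folklore] -/
theorem helper_sphereHomotopy_keyEstimate : ∀ (τ lam lamf : ℝ) (w z : ℂ), 0 ≤ τ → τ ≤ 1 → 0 < lam → 0 < lamf → w ≠ 0 → 2 ≤ ‖(lam : ℂ) * w⁻¹‖ → ‖z - (lam : ℂ) * w⁻¹‖ ≤ 1 → ((1 - τ : ℝ) : ℂ) * z⁻¹ + (τ : ℂ) * ((lamf : ℂ)⁻¹ * w) ≠ 0 := by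
  intro τ lam lamf w z hτ0 hτ1 hlam hlamf hw hξ hz
  set ξ : ℂ := (lam : ℂ) * w⁻¹ with hξ_def
  have hlam0 : (lam : ℂ) ≠ 0 := Complex.ofReal_ne_zero.2 hlam.ne'
  have hlamf0 : (lamf : ℂ) ≠ 0 := Complex.ofReal_ne_zero.2 hlamf.ne'
  have hξ0 : ξ ≠ 0 := mul_ne_zero hlam0 (inv_ne_zero hw)
  have hz1 : 1 ≤ ‖z‖ := by
    have h1 := norm_sub_norm_le ξ z
    rw [← norm_neg, neg_sub] at hz
    linarith
  have hz0 : z ≠ 0 := by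
    rintro rfl
    rw [norm_zero] at hz1
    exact absurd hz1 (by norm_num)
  -- `w / lamf = κ ξ⁻¹` with `κ = lam / lamf`
  have hw' : (lamf : ℂ)⁻¹ * w = ((lam / lamf : ℝ) : ℂ) * ξ⁻¹ := by
    rw [hξ_def, Complex.ofReal_div]
    field_simp
  set κ : ℝ := lam / lamf with hκ_def
  have hκ : 0 < κ := div_pos hlam hlamf
  rw [hw']
  -- the numerator `(1 - τ) ξ + τ κ z` after multiplying by `z ξ`
  set e : ℂ := z - ξ with he_def
  have he : ‖e‖ ≤ 1 := hz
  have hnum : ((1 - τ : ℝ) : ℂ) * ξ + ((τ * κ : ℝ) : ℂ) * z ≠ 0 := by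
    have hsplit : ((1 - τ : ℝ) : ℂ) * ξ + ((τ * κ : ℝ) : ℂ) * z =
        ((1 - τ + τ * κ : ℝ) : ℂ) * ξ + ((τ * κ : ℝ) : ℂ) * e := by
      rw [he_def]; push_cast; ring
    intro h0
    have hA : ‖((1 - τ + τ * κ : ℝ) : ℂ) * ξ‖ = (1 - τ + τ * κ) * ‖ξ‖ := by
      rw [norm_mul, Complex.norm_real, Real.norm_of_nonneg (by nlinarith)]
    have hB : ‖((τ * κ : ℝ) : ℂ) * e‖ ≤ τ * κ := by
      rw [norm_mul, Complex.norm_real, Real.norm_of_nonneg (by positivity)]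
      exact mul_le_of_le_one_right (by positivity) he
    have hlow := norm_sub_norm_le (((1 - τ + τ * κ : ℝ) : ℂ) * ξ) (-(((τ * κ : ℝ) : ℂ) * e))
    rw [sub_neg_eq_add, norm_neg, ← hsplit, h0, norm_zero, hA] at hlow
    have hc : 0 ≤ 1 - τ + τ * κ := by nlinarith [mul_nonneg hτ0 hκ.le]
    have h2 : 2 * (1 - τ + τ * κ) ≤ (1 - τ + τ * κ) * ‖ξ‖ := by
      rw [mul_comm]
      exact mul_le_mul_of_nonneg_left hξ hc
    nlinarith [mul_nonneg hτ0 hκ.le]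
  intro h0
  apply hnum
  have h1 : (((1 - τ : ℝ) : ℂ) * z⁻¹ + (τ : ℂ) * (((κ : ℝ) : ℂ) * ξ⁻¹)) * (z * ξ) =
      ((1 - τ : ℝ) : ℂ) * ξ + ((τ * κ : ℝ) : ℂ) * z := by
    push_cast
    field_simp
  rw [← h1, h0, zero_mul]

end Summit.SmoothPoincare4.SmoothPoincare4.Theorems.WitnessCharge.PencilIncompleteness

end
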